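import Summits.QuantumFields.YangMills.Theorems.BalabanUVNodesN15KingModelCovariantBlockOperator
import Summits.QuantumFields.YangMills.Theorems.BalabanUVNodesN15KingModelComplexLinkOperator
import HarnessLib

/-!
# BalabanUVNodes ∕ N15 — THE KING-MODEL RUNG (PART Ϩ-a): THE HOLOMORPHIC FAMILY THROUGH KING's ∕ BAŁABAN's FULL ONE-LEVEL OPERATOR — `A(U,V) = M_{U,V} + a·Q♯(V)Q(U)`, the covariant
# block term at a TWO-SIDED complex link field: `Q(U)^*` with the backward transporters `U(b)^*` replaced by independent variables `V(b)` (print's `R(U)`: `U^* ↦ U⁻¹` on `Gᶜ`);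
# the reversed transport `V(Γ_{x,y})`, slices `V = Uᴴ` (PART Ϥ-d's `A₀(U)`, every `U`) and `V = U⁻¹` (unitary `U`), adjoint symmetry, fibre blocks
# (Track A, DAG node N15 = NE2; FAN-OUT v1.1 §N15 s3 «KING-MODEL RUNG … + what the curved case adds»; count-neutral)

HONEST FRAMING.  Count-neutral (cell `pub-ymgap`, seat `pub-ymgap-dag-n15-e` g51; `--supports stmt-QuantumFields-27247 --as helper` = K3ᴬ, KEY MAP v3).  Definitions and algebra only:
King's one-level comparison model on the fine torus `T_η = Π_μℤ∕(LM_μ)` (`η = L⁻¹`), Bałaban's one-level covariant block mean along a tree contour system `T` (PART Ϥ-b∕Ϥ-c), any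
fibre `𝕜ⁿ`; PART Ϛ-a complexified the FINE covariance layer (`cxLapF K c m² U V = M_{U,V}`), this file complexifies the BLOCK TERM the same way and assembles the full operator.
NOT Bałaban's multi-level `G_k(U)` (3.15) nor the random-walk expansion (3.47)–(3.55); NOT a node discharge (N15 of record untouched); nothing continuum ∕ ℝ⁴ ∕ OS ∕ Clay.

THE OBJECT.  [Balaban1985BackgroundPropagators] §3.B p.399 l.37–40: «… extend the operators to configurations with values in the complexified group Gᶜ and to prove the usual
complex analyticity»; the averaging operators carry `R(U(Γ))` with `R(U) = U^*` on `G`, continued as `U⁻¹` on `Gᶜ` ((3.3) p.391, (3.19) p.393, (3.50) p.400).  In the two-sided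
bookkeeping of PART Ϛ (forward variables `U`, backward variables `V`; `V = Uᴴ` is the Hermitian slice, `V = U⁻¹` print's slice) the adjoint block mean `Q(U)^* = L^{d+1}Q(U)ᴴ` has
entries `L^{−(d+1)}·U(Γ_{y,x})ᴴ = L^{−(d+1)}·U(b₁)^*⋯U(b_k)^*` (contour `Γ_{y,x} = b_k⋯b₁` from the corner), and its holomorphic continuation is `Q♯(V)`, entries `L^{−(d+1)}·V(b₁)⋯V(b_k)`
— the REVERSED transport `V(Γ_{x,y})` (§1).  The full operator `A(U,V) = M_{U,V} + aL^{d+1}·Q♯(V)Q(U)` (§3) is complex-bilinear-polynomial in `(U,V)`, equals PART Ϥ-d's Hermitian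
`A₀(U) = fullOpU T M a c m² U` on `V = Uᴴ` for EVERY `U`, and on `V = U⁻¹` for unitary `U`.

THE RESULTS (`T` any tree contour system, `M` the block torus, `U, V` ANY link fields unless stated):
* §1 def **`treeHolRev M T V b j`** (`V(Γ_{x,y}) = V(b_k)·…`, reversed product); `treeHolRev_root`, `treeHolRev_of_ne_root`, ★ `treeHol_conjTranspose` (`U(Γ)ᴴ = Vᴴ…`: `(treeHol U)ᴴ =
  treeHolRev (Uᴴ)`), `treeHolRev_conjTranspose`, ★ `treeHolRev_inv` (`treeHolRev (U⁻¹) = (treeHol U)⁻¹` for bondwise-invertible `U` — print's `R(U(Γ))` on `Gᶜ`), `treeHolRev_inv_of_unitary`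
  (`= (treeHol U)ᴴ`), `treeHolRev_const_one`, `treeHolRev_congr_block`.
* §2 def **`cxQadj T M V`** (the holomorphic `Q^*`, an `(T_η × n) × (T₁ × n)` matrix); `cxQadj_apply_site`, ★★ **`cxQadj_adjoint`** (`cxQadj (Uᴴ) = (covQ U)ᴴ`, every `U`), `conjTranspose_cxQadj`
  (`(cxQadj V)ᴴ = covQ (Vᴴ)`), `cxQadj_inv_of_unitary`; ★ **`blk_cxGram_site`** (`blk (Q♯(V)Q(U)) x_j x′_{j′} = [same block]·L^{−2(d+1)}·V(Γ_{x_j,y})U(Γ_{y,x′_{j′}})`), `blk_cxGram_of_ne`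
  (different blocks ⟹ `0`).
* §3 def **`cxFullOp T M a c m² U V = cxLapF (fine L M) c m² U V + (aL^{d+1})·(cxQadj V ⬝ covQ U)`**; ★★★ **`cxFullOp_adjoint`** (`A(U,Uᴴ) = fullOpU T M a c m² U`, EVERY `U`),
  ★★ **`cxFullOp_inv_of_unitary`** (`A(U,U⁻¹) = A₀(U)`, unitary `U` — print's `Gᶜ` slice through the unitary fields), ★ `cxFullOp_conjTranspose` (`A(U,V)ᴴ = A(Vᴴ,Uᴴ)`: Hermitian exactly on
  the slice `V = Uᴴ`), `cxFullOp_zero_blockCoupling` (`a = 0`: PART Ϛ's `M_{U,V}`), `cxFullOp_sub_cxFullOp` (the difference of two members: hopping difference + block-term difference),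
  `blk_cxFullOp_blockTerm` (fibre blocks of the block term).
PRIOR TREE ART (by name, not restated): Ϥ-b (`BlockTree`, `treeHol`, `treeHol_root∕_of_ne_root∕_mem_unitaryGroup∕_const_one∕_congr_block`, `BlockTree.induction`), Ϥ-c (`covQ`, `covQ_apply_site`),
Ϥ-d (`fullOpU`), Ϛ-a (`cxLapF`, `cxLapF_adjoint`, `cxLapF_inv_of_unitary`, `cxLapF_conjTranspose`, `cxLapF_sub_cxLapF`), `King1986.Torus` (`site`, `site_injective`, `blockOf_site`),
`LatticeDiamagneticInequality.blk`, Mathlib.  Dedup (rg at filing): basename 0 files; needles `treeHolRev|cxQadj|cxFullOp|cxGram` 0 files in `Summits/QuantumFields` + `Literature/MathematicalPhysics`.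
presearch: n/a (definitions following the print; the two-sided device is PART Ϛ's).  Locators: [Balaban1985BackgroundPropagators] (3.3) p.391, (3.19) p.393, (3.24)–(3.26) p.394–395,
§3.B p.399 l.37–40, (3.50) p.400, Thm 3.4 p.400; [King1986] (2.11)–(2.13) p.653, (4.4)–(4.5) p.670; [Balaban1984PropagatorsI] (1.7) p.18.  0 `sorry`, 3 `def`.
-/

noncomputable section
open scoped BigOperators ComplexConjugate
open Finset Matrix

namespace Summit.QuantumFields.YangMills.BalabanUVNodes.N15KingModelRung.Analytic

open Literature.MathematicalPhysics.QuantumFieldTheory.LatticeDiamagneticInequality (blk)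
open Literature.MathematicalPhysics.QuantumFieldTheory.Balaban1983to89.B5Prop11Plancherel (Tor fine unitVec)
open Literature.MathematicalPhysics.QuantumFieldTheory.King1986.Torus (site site_injective blockOf blockOf_site)
open Summit.QuantumFields.YangMills.BalabanUVNodes.N15KingModelRung.Covariant (covLapF cxLapF cxHop cxLapF_adjoint cxLapF_inv_of_unitary cxLapF_conjTranspose cxLapF_sub_cxLapF)
open Summit.QuantumFields.YangMills.BalabanUVNodes.N15KingModelRung.CovariantBlock
  (BlockTree treeHol treeHol_root treeHol_of_ne_root treeHol_mem_unitaryGroup treeHol_const_one covQ covQ_apply_site fullOpU)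

variable {d : ℕ} {L : ℕ} [NeZero L] (T : BlockTree d L) (M : Fin (d + 1) → ℕ) [hM : ∀ μ, NeZero (M μ)]
variable {𝕜 : Type*} [RCLike 𝕜] {n : Type*} [Fintype n] [DecidableEq n]

/-! ## §1 The reversed transport `V(Γ_{x,y})` -/

section Transport

/-- THE REVERSED TRANSPORT `V(Γ_{x,y})` along the contour from `x = site b j` back to the corner `y` of block `b`: the product of the backward link variables of the contour bonds in
the order they are met from `x`, i.e. `V(b_k)·V(Γ_{x⁻,y})` with `b_k` the LAST bond of `Γ_{y,x}` — for `V = Uᴴ` this is `U(Γ_{y,x})ᴴ`, for `V = U⁻¹` it is `U(Γ_{y,x})⁻¹` (print's `R(U(Γ))`).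
[cite: Balaban1985BackgroundPropagators, (3.3) p.391, (3.19) p.393, §3.B p.399 l.37–40; King1986, (2.11)–(2.12) p.653] -/
def treeHolRev (T : BlockTree d L) (V : Tor (fine L M) × Fin (d + 1) → Matrix n n 𝕜) (b : Tor M) (j : Fin (d + 1) → Fin L) : Matrix n n 𝕜 :=
  if _h : j = T.root then 1 else V (site L M b (T.parent j), T.axis j) * treeHolRev T V b (T.parent j)
termination_by T.depth j
decreasing_by exact T.depth_parent_lt (by assumption)

omit hM in
/-- No transport at the corner. [cite: Balaban1985BackgroundPropagators, (3.19) p.393] -/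
theorem treeHolRev_root (V : Tor (fine L M) × Fin (d + 1) → Matrix n n 𝕜) (b : Tor M) : treeHolRev M T V b T.root = 1 := by
  rw [treeHolRev]; simp

omit hM in
/-- One more bond, multiplied on the LEFT: `V(Γ_{x,y}) = V(x⁻,μ)·V(Γ_{x⁻,y})`. [cite: Balaban1985BackgroundPropagators, (3.19) p.393; King1986, (2.12) p.653] -/
theorem treeHolRev_of_ne_root (V : Tor (fine L M) × Fin (d + 1) → Matrix n n 𝕜) (b : Tor M) {j : Fin (d + 1) → Fin L} (hj : j ≠ T.root) :
    treeHolRev M T V b j = V (site L M b (T.parent j), T.axis j) * treeHolRev M T V b (T.parent j) := by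
  rw [treeHolRev, dif_neg hj]

omit hM in
/-- ★ THE ADJOINT OF THE TRANSPORT IS THE REVERSED TRANSPORT OF THE ADJOINT FIELD: `U(Γ_{y,x})ᴴ = Uᴴ(Γ_{x,y})`, i.e. `(treeHol U b j)ᴴ = treeHolRev (Uᴴ) b j`.
[cite: Balaban1985BackgroundPropagators, (3.19) p.393, (3.24) p.394] -/
theorem treeHol_conjTranspose (U : Tor (fine L M) × Fin (d + 1) → Matrix n n 𝕜) (b : Tor M) :
    ∀ j, (treeHol M T U b j)ᴴ = treeHolRev M T (fun bd => (U bd)ᴴ) b j := by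
  refine T.induction (P := fun j => (treeHol M T U b j)ᴴ = treeHolRev M T (fun bd => (U bd)ᴴ) b j) ?_ fun j hj ih => ?_
  · rw [treeHol_root, treeHolRev_root, conjTranspose_one]
  · rw [treeHol_of_ne_root T M U b hj, treeHolRev_of_ne_root T M _ b hj, conjTranspose_mul, ih]

omit hM in
/-- `(treeHolRev V b j)ᴴ = treeHol (Vᴴ) b j`. [cite: Balaban1985BackgroundPropagators, (3.19) p.393] -/
theorem treeHolRev_conjTranspose (V : Tor (fine L M) × Fin (d + 1) → Matrix n n 𝕜) (b : Tor M) (j : Fin (d + 1) → Fin L) :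
    (treeHolRev M T V b j)ᴴ = treeHol M T (fun bd => (V bd)ᴴ) b j := by
  have h := treeHol_conjTranspose T M (fun bd => (V bd)ᴴ) b j
  simp only [conjTranspose_conjTranspose] at h
  rw [← h, conjTranspose_conjTranspose]

omit hM in
/-- ★ **PRINT's `R(U(Γ))` ON `Gᶜ`**: the reversed transport of the (matrix-)inverse field is the inverse of the transport: `U⁻¹(Γ_{x,y}) = U(Γ_{y,x})⁻¹` (Mathlib's `Matrix.inv`, so no
invertibility hypothesis is needed for the identity; it is print's `R(U(Γ))` for bondwise-invertible `U`).
[cite: Balaban1985BackgroundPropagators, (3.3) p.391, §3.B p.399 l.37–40] -/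
theorem treeHolRev_inv (U : Tor (fine L M) × Fin (d + 1) → Matrix n n 𝕜) (b : Tor M) :
    ∀ j, treeHolRev M T (fun bd => (U bd)⁻¹) b j = (treeHol M T U b j)⁻¹ := by
  refine T.induction (P := fun j => treeHolRev M T (fun bd => (U bd)⁻¹) b j = (treeHol M T U b j)⁻¹) ?_ fun j hj ih => ?_
  · rw [treeHolRev_root, treeHol_root, inv_one]
  · rw [treeHolRev_of_ne_root T M _ b hj, treeHol_of_ne_root T M U b hj, ih, Matrix.mul_inv_rev]

omit hM in
/-- For a unitary field: `U⁻¹(Γ_{x,y}) = U(Γ_{y,x})ᴴ` (the two slices meet). [cite: Balaban1985BackgroundPropagators, §3.B p.399 l.37–40] -/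
theorem treeHolRev_inv_of_unitary {U : Tor (fine L M) × Fin (d + 1) → Matrix n n 𝕜} (hU : ∀ bd, U bd ∈ Matrix.unitaryGroup n 𝕜) (b : Tor M) (j : Fin (d + 1) → Fin L) :
    treeHolRev M T (fun bd => (U bd)⁻¹) b j = (treeHol M T U b j)ᴴ := by
  have h : (fun bd => (U bd)⁻¹) = fun bd => (U bd)ᴴ := by
    funext bd
    have h1 : (U bd)ᴴ * U bd = 1 := by simpa only [star_eq_conjTranspose] using Matrix.mem_unitaryGroup_iff'.mp (hU bd)
    exact Matrix.inv_eq_left_inv h1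
  rw [h, treeHol_conjTranspose]

omit hM in
/-- No transport at `V ≡ 1`. [cite: King1986, (2.11) p.653] -/
theorem treeHolRev_const_one (b : Tor M) (j : Fin (d + 1) → Fin L) : treeHolRev M T (fun _ => (1 : Matrix n n 𝕜)) b j = 1 := by
  have h := treeHol_conjTranspose T M (fun _ => (1 : Matrix n n 𝕜)) b j
  simp only [conjTranspose_one] at h
  rw [← h, treeHol_const_one, conjTranspose_one]

omit hM in
/-- The reversed transport only reads the field on the contour bonds of the block. [folklore] -/
theorem treeHolRev_congr_block {V W : Tor (fine L M) × Fin (d + 1) → Matrix n n 𝕜} (b : Tor M)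
    (h : ∀ j, j ≠ T.root → V (site L M b (T.parent j), T.axis j) = W (site L M b (T.parent j), T.axis j)) : ∀ j, treeHolRev M T V b j = treeHolRev M T W b j := by
  refine T.induction (P := fun j => treeHolRev M T V b j = treeHolRev M T W b j) (by rw [treeHolRev_root, treeHolRev_root]) fun j hj ih => ?_
  rw [treeHolRev_of_ne_root T M V b hj, treeHolRev_of_ne_root T M W b hj, ih, h j hj]

end Transport

/-! ## §2 The holomorphic adjoint block mean `Q♯(V)` and the fibre blocks of `Q♯(V)Q(U)` -/

section Qadj

/-- THE HOLOMORPHIC ADJOINT BLOCK MEAN `Q♯(V)`: the `(T_η × n) × (T₁ × n)` matrix with entries `Q♯(V)((x,k),(y,i)) = Σ_j [x = site y j]·L^{−(d+1)}·V(Γ_{x,y})_{ki}` — `Q(U)ᴴ` with the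
backward transporters continued to independent variables (`= Q(U)ᴴ` at `V = Uᴴ`, §2; `L^{d+1}·Q♯(U⁻¹)` is print's `Q(U)^*` continued to `Gᶜ`).
[cite: Balaban1985BackgroundPropagators, (3.19) p.393, (3.24) p.394, §3.B p.399 l.37–40; King1986, (2.11)–(2.13) p.653] -/
def cxQadj (V : Tor (fine L M) × Fin (d + 1) → Matrix n n 𝕜) : Matrix (Tor (fine L M) × n) (Tor M × n) 𝕜 :=
  fun xk yi => ∑ j : Fin (d + 1) → Fin L, if xk.1 = site L M yi.1 j then ((L : 𝕜) ^ (d + 1))⁻¹ * treeHolRev M T V yi.1 j xk.2 yi.2 else 0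

/-- The entry of `Q♯(V)` at a block point: `Q♯(V)((site y′ j, k),(y,i)) = [y′ = y]·L^{−(d+1)}·V(Γ_{site y j, y})_{ki}`. [cite: Balaban1985BackgroundPropagators, (3.19) p.393] -/
theorem cxQadj_apply_site (V : Tor (fine L M) × Fin (d + 1) → Matrix n n 𝕜) (y y' : Tor M) (i k : n) (j : Fin (d + 1) → Fin L) :
    cxQadj T M V (site L M y' j, k) (y, i) = if y' = y then ((L : 𝕜) ^ (d + 1))⁻¹ * treeHolRev M T V y j k i else 0 := by
  simp only [cxQadj]
  by_cases hy : y' = y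
  · subst hy
    rw [if_pos rfl, Finset.sum_eq_single j]
    · rw [if_pos rfl]
    · intro j' _ hj'
      rw [if_neg]
      intro h
      exact hj' ((Prod.mk.inj (site_injective L M (a₁ := (y', j)) (a₂ := (y', j')) h)).2).symm
    · intro h; exact absurd (Finset.mem_univ j) h
  · rw [if_neg hy]
    refine Finset.sum_eq_zero fun j' _ => ?_
    rw [if_neg]
    intro h
    exact hy ((Prod.mk.inj (site_injective L M (a₁ := (y', j)) (a₂ := (y, j')) h)).1)

omit hM in
/-- ★★ **ON THE ADJOINT SLICE `Q♯` IS THE ADJOINT BLOCK MEAN**: `cxQadj T M (Uᴴ) = (covQ T M U)ᴴ` for EVERY link field `U`. [cite: Balaban1985BackgroundPropagators, (3.24) p.394, §3.B p.399 l.37–40] -/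
theorem cxQadj_adjoint (U : Tor (fine L M) × Fin (d + 1) → Matrix n n 𝕜) : cxQadj T M (fun bd => (U bd)ᴴ) = (covQ T M U)ᴴ := by
  ext ⟨x, k⟩ ⟨y, i⟩
  rw [conjTranspose_apply]
  simp only [cxQadj, covQ, star_sum, apply_ite (star : 𝕜 → 𝕜), star_zero, star_mul', ← treeHol_conjTranspose, conjTranspose_apply]
  refine Finset.sum_congr rfl fun j _ => ?_
  congr 1
  rw [RCLike.star_def, map_inv₀, map_pow, map_natCast]

omit hM in
/-- `(cxQadj V)ᴴ = covQ (Vᴴ)`. [cite: Balaban1985BackgroundPropagators, (3.19) p.393] -/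
theorem conjTranspose_cxQadj (V : Tor (fine L M) × Fin (d + 1) → Matrix n n 𝕜) : (cxQadj T M V)ᴴ = covQ T M (fun bd => (V bd)ᴴ) := by
  have h := cxQadj_adjoint T M (fun bd => (V bd)ᴴ)
  simp only [conjTranspose_conjTranspose] at h
  rw [h, conjTranspose_conjTranspose]

omit hM in
/-- ★ ON PRINT's SLICE THROUGH A UNITARY FIELD: `cxQadj T M (U⁻¹) = (covQ T M U)ᴴ`. [cite: Balaban1985BackgroundPropagators, §3.B p.399 l.37–40] -/
theorem cxQadj_inv_of_unitary {U : Tor (fine L M) × Fin (d + 1) → Matrix n n 𝕜} (hU : ∀ bd, U bd ∈ Matrix.unitaryGroup n 𝕜) :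
    cxQadj T M (fun bd => (U bd)⁻¹) = (covQ T M U)ᴴ := by
  have h : (fun bd => (U bd)⁻¹) = fun bd => (U bd)ᴴ := by
    funext bd
    have h1 : (U bd)ᴴ * U bd = 1 := by simpa only [star_eq_conjTranspose] using Matrix.mem_unitaryGroup_iff'.mp (hU bd)
    exact Matrix.inv_eq_left_inv h1
  rw [h, cxQadj_adjoint]

/-- ★ **THE FIBRE BLOCKS OF THE COMPLEXIFIED GRAM MATRIX**: `blk (Q♯(V)Q(U)) (site β j) (site β′ j′) = [β = β′]·L^{−2(d+1)}·V(Γ_{x_j,β})·U(Γ_{β,x_{j′}})` — block-diagonal in the blocks, a product of a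
reversed `V`-transport and a `U`-transport through the corner (PART Ϧ-f `blk_gram_covQ_site` is the slice `V = Uᴴ`). [cite: Balaban1985BackgroundPropagators, (3.19) p.393, (3.24) p.394] -/
theorem blk_cxGram_site (U V : Tor (fine L M) × Fin (d + 1) → Matrix n n 𝕜) (β β' : Tor M) (j j' : Fin (d + 1) → Fin L) :
    blk (cxQadj T M V * covQ T M U) (site L M β j) (site L M β' j')
      = if β = β' then ((((L : ℝ) ^ (d + 1))⁻¹ ^ 2 : ℝ) : 𝕜) • (treeHolRev M T V β j * treeHol M T U β' j') else 0 := by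
  have hc : ((L : 𝕜) ^ (d + 1))⁻¹ = (((((L : ℝ) ^ (d + 1))⁻¹ : ℝ)) : 𝕜) := by push_cast; ring
  ext k k'
  simp only [blk, Matrix.of_apply, Matrix.mul_apply, Fintype.sum_prod_type, covQ_apply_site, cxQadj_apply_site]
  by_cases h : β = β'
  · subst h
    rw [if_pos rfl, Finset.sum_eq_single β]
    · simp only [if_true, Matrix.smul_apply, Matrix.mul_apply, smul_eq_mul, Finset.mul_sum, hc]
      refine Finset.sum_congr rfl fun i _ => ?_
      push_cast; ring
    · intro b _ hb; exact Finset.sum_eq_zero fun i _ => by rw [if_neg (Ne.symm hb), zero_mul]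
    · intro hβ; exact absurd (Finset.mem_univ β) hβ
  · rw [if_neg h]
    refine Finset.sum_eq_zero fun b _ => Finset.sum_eq_zero fun i _ => ?_
    by_cases hb : β = b
    · subst hb; rw [if_neg h, mul_zero]
    · rw [if_neg hb, zero_mul]

/-- Different blocks do not talk through the block term: `blockOf x ≠ blockOf x′ ⟹ blk (Q♯(V)Q(U)) x x′ = 0`. [cite: Balaban1985BackgroundPropagators, (3.19) p.393] -/
theorem blk_cxGram_of_ne (U V : Tor (fine L M) × Fin (d + 1) → Matrix n n 𝕜) {x x' : Tor (fine L M)} (h : blockOf L M x ≠ blockOf L M x') :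
    blk (cxQadj T M V * covQ T M U) x x' = 0 := by
  obtain ⟨⟨β, j⟩, rfl⟩ := (Literature.MathematicalPhysics.QuantumFieldTheory.King1986.Torus.blockEquiv L M).surjective x
  obtain ⟨⟨β', j'⟩, rfl⟩ := (Literature.MathematicalPhysics.QuantumFieldTheory.King1986.Torus.blockEquiv L M).surjective x'
  simp only [Literature.MathematicalPhysics.QuantumFieldTheory.King1986.Torus.blockEquiv_apply, blockOf_site] at h ⊢
  rw [blk_cxGram_site, if_neg h]

end Qadj

/-! ## §3 The full operator at a two-sided complex link field -/

section Full

/-- KING's ∕ BAŁABAN's FULL ONE-LEVEL OPERATOR AT A TWO-SIDED COMPLEX LINK FIELD: `A(U,V) = M_{U,V} + aL^{d+1}·Q♯(V)Q(U)` = `(−cΔ + m²)` with forward transporters `U`, backward transporters `V`,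
plus the covariant block term with `Q(U)^*` continued to `L^{d+1}Q♯(V)` — the holomorphic family through `A₀(U) = −cΔ_U + m² + aQ(U)^*Q(U)` (PART Ϥ-d `fullOpU`).
[cite: Balaban1985BackgroundPropagators, (3.24)–(3.26) p.394–395, §3.B p.399 l.37–40, Thm 3.4 p.400; King1986, (2.13) p.653, (4.4)–(4.5) p.670] -/
def cxFullOp (a c m2 : ℝ) (U V : Tor (fine L M) × Fin (d + 1) → Matrix n n 𝕜) : Matrix (Tor (fine L M) × n) (Tor (fine L M) × n) 𝕜 :=
  cxLapF (fine L M) c m2 U V + ((a * (L : ℝ) ^ (d + 1) : ℝ) : 𝕜) • (cxQadj T M V * covQ T M U)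

/-- ★★★ **ON THE ADJOINT SLICE THE FAMILY IS PART Ϥ-d's HERMITIAN OPERATOR**: `A(U,Uᴴ) = A₀(U) = fullOpU T M a c m² U` for EVERY link field `U` (unitary or not).
[cite: Balaban1985BackgroundPropagators, (3.24)–(3.26) p.394–395, §3.B p.399 l.37–40] -/
theorem cxFullOp_adjoint (a c m2 : ℝ) (U : Tor (fine L M) × Fin (d + 1) → Matrix n n 𝕜) :
    cxFullOp T M a c m2 U (fun bd => (U bd)ᴴ) = fullOpU T M a c m2 U := by
  rw [cxFullOp, cxQadj_adjoint, cxLapF_adjoint]; rfl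

/-- ★★ **PRINT's `Gᶜ` SLICE THROUGH THE UNITARY FIELDS**: for unitary `U`, `A(U,U⁻¹) = A₀(U)` — the one-variable holomorphic family `U ↦ A(U,U⁻¹)` of [B9] §3.B extends PART Ϥ-d's operator
off the unitary fields. [cite: Balaban1985BackgroundPropagators, §3.B p.399 l.37–40, Thm 3.4 p.400] -/
theorem cxFullOp_inv_of_unitary (a c m2 : ℝ) {U : Tor (fine L M) × Fin (d + 1) → Matrix n n 𝕜} (hU : ∀ bd, U bd ∈ Matrix.unitaryGroup n 𝕜) :
    cxFullOp T M a c m2 U (fun bd => (U bd)⁻¹) = fullOpU T M a c m2 U := by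
  have h : (fun bd => (U bd)⁻¹) = fun bd => (U bd)ᴴ := by
    funext bd
    have h1 : (U bd)ᴴ * U bd = 1 := by simpa only [star_eq_conjTranspose] using Matrix.mem_unitaryGroup_iff'.mp (hU bd)
    exact Matrix.inv_eq_left_inv h1
  rw [h, cxFullOp_adjoint]

/-- ★ THE ADJOINT SWAPS AND STARS THE TWO FIELDS: `A(U,V)ᴴ = A(Vᴴ,Uᴴ)` — the family is Hermitian exactly on the slice `V = Uᴴ` (Ϥ-d `isHermitian_fullOpU`).
[cite: Balaban1985BackgroundPropagators, (3.26) p.395] -/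
theorem cxFullOp_conjTranspose (a c m2 : ℝ) (U V : Tor (fine L M) × Fin (d + 1) → Matrix n n 𝕜) :
    (cxFullOp T M a c m2 U V)ᴴ = cxFullOp T M a c m2 (fun bd => (V bd)ᴴ) (fun bd => (U bd)ᴴ) := by
  rw [cxFullOp, cxFullOp, conjTranspose_add, cxLapF_conjTranspose, conjTranspose_smul, conjTranspose_mul, conjTranspose_cxQadj, ← cxQadj_adjoint T M U,
    RCLike.star_def, RCLike.conj_ofReal]

/-- WITHOUT BLOCK COUPLING (`a = 0`) the family is PART Ϛ's fine operator `M_{U,V}`. [cite: Balaban1985BackgroundPropagators, (3.23) p.394] -/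
theorem cxFullOp_zero_blockCoupling (c m2 : ℝ) (U V : Tor (fine L M) × Fin (d + 1) → Matrix n n 𝕜) :
    cxFullOp T M 0 c m2 U V = cxLapF (fine L M) c m2 U V := by
  rw [cxFullOp, zero_mul, RCLike.ofReal_zero, zero_smul, add_zero]

/-- THE DIFFERENCE OF TWO MEMBERS: `A(U,V) − A(U′,V′) = (T_{U′,V′} − T_{U,V}) + aL^{d+1}·(Q♯(V)Q(U) − Q♯(V′)Q(U′))` (the site weights cancel, Ϛ-a `cxLapF_sub_cxLapF`).
[cite: Balaban1985BackgroundPropagators, (3.48)–(3.50) pp.398–400] -/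
theorem cxFullOp_sub_cxFullOp (a c m2 : ℝ) (U V U' V' : Tor (fine L M) × Fin (d + 1) → Matrix n n 𝕜) :
    cxFullOp T M a c m2 U V - cxFullOp T M a c m2 U' V'
      = (cxHop (fine L M) c U' V' - cxHop (fine L M) c U V) + ((a * (L : ℝ) ^ (d + 1) : ℝ) : 𝕜) • (cxQadj T M V * covQ T M U - cxQadj T M V' * covQ T M U') := by
  rw [cxFullOp, cxFullOp, smul_sub, ← cxLapF_sub_cxLapF]; abel

/-- THE FIBRE BLOCKS OF THE BLOCK TERM: `blk (aL^{d+1}·Q♯(V)Q(U)) (site β j) (site β′ j′) = [β = β′]·aL^{−(d+1)}·V(Γ_{x_j,β})U(Γ_{β,x_{j′}})`.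
[cite: Balaban1985BackgroundPropagators, (3.24) p.394; King1986, (2.13) p.653] -/
theorem blk_cxFullOp_blockTerm (a : ℝ) (U V : Tor (fine L M) × Fin (d + 1) → Matrix n n 𝕜) (β β' : Tor M) (j j' : Fin (d + 1) → Fin L) :
    blk (((a * (L : ℝ) ^ (d + 1) : ℝ) : 𝕜) • (cxQadj T M V * covQ T M U)) (site L M β j) (site L M β' j')
      = if β = β' then (((a * ((L : ℝ) ^ (d + 1))⁻¹ : ℝ)) : 𝕜) • (treeHolRev M T V β j * treeHol M T U β' j') else 0 := by
  have hL : ((L : ℝ) ^ (d + 1)) ≠ 0 := pow_ne_zero _ (by exact_mod_cast NeZero.ne L)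
  have hblk : blk (((a * (L : ℝ) ^ (d + 1) : ℝ) : 𝕜) • (cxQadj T M V * covQ T M U)) (site L M β j) (site L M β' j')
      = ((a * (L : ℝ) ^ (d + 1) : ℝ) : 𝕜) • blk (cxQadj T M V * covQ T M U) (site L M β j) (site L M β' j') := by
    ext k k'; simp only [blk, Matrix.of_apply, Matrix.smul_apply]
  rw [hblk, blk_cxGram_site]
  by_cases h : β = β'
  · rw [if_pos h, if_pos h, smul_smul, ← RCLike.ofReal_mul]
    congr 1
    push_cast
    field_simp
  · rw [if_neg h, if_neg h, smul_zero]

end Full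

end Summit.QuantumFields.YangMills.BalabanUVNodes.N15KingModelRung.Analytic

end
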